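import Literature.Analysis.FluidPDE.CaloricRemainderLocalEnergy
import HarnessLib

/-!
# The energy inequality of the caloric remainder with the coupling term kept raw

Analysis/FluidPDE proof file (theorems only, no definitions, no named facts), a companion of
`CaloricRemainderLocalEnergy.lean` on the way to the discharge of the named fact
`Literature.Analysis.FluidPDE.jia_sverak_2013_lemma_8` (Jia–Šverák 2013, Lemma 8: the uniform
initial layer `‖u(t) - e^{tΔ}u₀‖_{L²(B₁(x₀))} ≤ h(t)` of local Leray solutions with `L³` data).

`caloric_remainder_local_energy_inequality` gives, for a distributional Navier–Stokes solution
`(u, p)` with the CKN local energy inequality and a smooth divergence-free caloric field `e`,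
the local energy inequality of `w = u - e` with the coupling term `-2∫∫ φ ⟪De(u), u⟫` un-expanded;
`caloric_remainder_energy_inequality` expands it and bounds the piece `⟪De(w), w⟫` by
`‖De‖ |w|²`, which is the right move for **bounded** data (`‖De(t)‖_∞ ≲ (νt)^{-1/2}‖u₀‖_∞` is
integrable in time) but not for `L³` data (`‖De(t)‖_∞ ≲ t⁻¹‖u₀‖₃` is not). For Lemma 8 the piece
`⟪De(w), w⟫` has to be integrated by parts onto `w` slice by slice and controlled through Giga's
`L⁵` bound of the free evolution; this file therefore records the intermediate form in which the
two pieces `⟪De(w), w⟫` and `⟪De(e), w⟫` are **kept**, while the two pieces that only need the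
divergence-free conditions are expanded exactly as in `caloric_remainder_energy_inequality`
(`∫∫ φ⟪De(w), e⟫ = -½∫∫ |e|² w·∇φ`, `∫∫ φ⟪De(e), e⟫ = -½∫∫ |e|² e·∇φ`):

  `2ν ∫∫ |∇w|² φ ≤ ∫∫ |w|²(φₜ + νΔφ) + ∫∫ (|w|² - |e|²) u·∇φ + 2∫∫ p w·∇φ
      - 2∫∫ φ ⟪De(w), w⟫ - 2∫∫ φ ⟪De(e), w⟫ + ∫∫ |e|² w·∇φ + ∫∫ (e·∇φ)|e|²`

(`caloric_remainder_energy_inequality_raw`; iterated integrals, `∇w = G - De`). The proof is the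
first half of the proof of `caloric_remainder_energy_inequality` (steps (0)–(ii) there), verbatim.

## Mathlib / tree search

Tree: `caloric_remainder_local_energy_inequality`, `integrable_of_bound_on_compact`,
`exists_forall_mem_norm_le_of_continuous` (`CaloricRemainderLocalEnergy.lean`);
`IsSpaceTimeTestOn.mul_smooth` (`CaloricTestFieldCalculus.lean`);
`integral_mul_divergence_add_eq_zero_left` (`WholeSpaceIBP.lean`). Nothing with the coupling
kept raw existed (`lean search 'caloric_remainder'`).

## References

* H. Jia, V. Šverák, *Minimal `L³`-initial data for potential Navier–Stokes singularities*,
  SIAM J. Math. Anal. 45 (2013) 1448–1459 = arXiv:1201.1592, Lemma 8 (p. 7). [JiaSverak2013]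
* P. G. Lemarié-Rieusset, *The Navier–Stokes problem in the 21st century*, CRC Press 2016,
  Thm. 14.7, proof pp. 515–516 (the three balances); Prop. 15.1. [LemarieRieusset2016]
* W. Rusin, V. Šverák, J. Funct. Anal. 260 (2011) 879–891 = arXiv:0911.0500, §4 p. 6.
  [RusinSverak2011]
-/

noncomputable section

open MeasureTheory TopologicalSpace Set Function Filter Topology InnerProductSpace
open scoped RealInnerProductSpace ENNReal NNReal Laplacian

namespace Literature.Analysis.FluidPDE

variable {E : Type*} [NormedAddCommGroup E] [InnerProductSpace ℝ E] [FiniteDimensional ℝ E]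
  [MeasurableSpace E] [BorelSpace E]

section Main

variable {Ω : Opens (ℝ × E)} {ν : ℝ} {u e : ℝ → E → E} {p : ℝ → E → ℝ}
  {G : ℝ → E → E →L[ℝ] E} {φ : ℝ → E → ℝ}

set_option maxHeartbeats 1600000 in
/-- **Energy inequality of the caloric remainder, coupling expanded but the `w`-pieces kept**
(Lemarié-Rieusset 2016, proof of Thm. 14.7, pp. 515–516; Rusin–Šverák 2011, §4 p. 6). In the
setting of `caloric_remainder_local_energy_inequality`, write `w = u - e`, `∇w = G - De`. The
coupling `-2 ∫∫ φ ⟪De(u), u⟫` is split by `u = w + e` into four pieces; the two pieces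
`∫∫ φ⟪De(w), e⟫ = -½ ∫∫ |e|² w·∇φ` and `∫∫ φ⟪De(e), e⟫ = -½ ∫∫ |e|² e·∇φ` are evaluated by the
weak divergence-freeness of `u` and of `e` (tested with `θ = ½|e|²φ`), the pieces `⟪De(w), w⟫`
and `⟪De(e), w⟫` are kept. Result (iterated integrals):
`2ν ∫∫ |∇w|²φ ≤ ∫∫ |w|²(φₜ + νΔφ) + ∫∫ (|w|² - |e|²) u·∇φ + 2∫∫ p w·∇φ - 2∫∫ φ⟪De(w), w⟫
 - 2∫∫ φ⟪De(e), w⟫ + ∫∫ |e|² w·∇φ + ∫∫ (e·∇φ)|e|²`.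
[cite: LemarieRieusset2016, Thm. 14.7, proof pp. 515–516] [cite: RusinSverak2011, §4 p. 6] -/
theorem caloric_remainder_energy_inequality_raw
    (hNS : IsDistributionalNSSolutionOn Ω ν 0 u p)
    (hG : HasWeakSpatialGradientOn Ω u G)
    (hG2 : ∀ K ⊆ (Ω : Set (ℝ × E)), IsCompact K →
      ∫⁻ z in K, ENNReal.ofReal (frobeniusNormSq (G z.1 z.2)) < ∞)
    (hLEI : ∀ φ : ℝ → E → ℝ, IsSpaceTimeTestOn Ω φ → (∀ t x, 0 ≤ φ t x) →
      2 * ν * ∫ t, ∫ x, frobeniusNormSq (G t x) * φ t x ≤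
        ∫ t, ∫ x, (‖u t x‖ ^ 2 * (timeDeriv φ t x + ν * Δ (φ t) x) +
          (‖u t x‖ ^ 2 + 2 * p t x) * ⟪u t x, gradient (φ t) x⟫ +
          2 * ⟪(0 : ℝ → E → E) t x, u t x⟫ * φ t x))
    (hu3 : ∀ K ⊆ (Ω : Set (ℝ × E)), IsCompact K → MemLp (uncurry u) 3 (volume.restrict K))
    (hp32 : ∀ K ⊆ (Ω : Set (ℝ × E)), IsCompact K → MemLp (uncurry p) (3 / 2) (volume.restrict K))
    (he : ContDiff ℝ (⊤ : ℕ∞) (uncurry e))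
    (hheat : ∀ z ∈ (Ω : Set (ℝ × E)), HasDerivAt (fun s => e s z.2) (ν • (Δ (e z.1)) z.2) z.1)
    (hdiv : ∀ t, VectorCalculus.IsDivFree (e t))
    (hφ : IsSpaceTimeTestOn Ω φ) (hφ0 : ∀ t x, 0 ≤ φ t x) :
    2 * ν * ∫ t, ∫ x, frobeniusNormSq (G t x - fderiv ℝ (e t) x) * φ t x ≤
      (∫ t, ∫ x, ‖u t x - e t x‖ ^ 2 * (timeDeriv φ t x + ν * Δ (φ t) x)) +
        (∫ t, ∫ x, (‖u t x - e t x‖ ^ 2 - ‖e t x‖ ^ 2) * ⟪u t x, gradient (φ t) x⟫) +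
        2 * (∫ t, ∫ x, p t x * ⟪u t x - e t x, gradient (φ t) x⟫) -
        2 * (∫ t, ∫ x, φ t x * ⟪fderiv ℝ (e t) x (u t x - e t x), u t x - e t x⟫) -
        2 * (∫ t, ∫ x, φ t x * ⟪fderiv ℝ (e t) x (e t x), u t x - e t x⟫) +
        (∫ t, ∫ x, ‖e t x‖ ^ 2 * ⟪u t x - e t x, gradient (φ t) x⟫) +
        ∫ t, ∫ x, ⟪e t x, gradient (φ t) x⟫ * ‖e t x‖ ^ 2 := by
  have h4 := caloric_remainder_local_energy_inequality hNS hG hG2 hLEI hu3 hp32 he hheat hdiv hφ hφ0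
  haveI : (volume : Measure (ℝ × E)).IsAddHaarMeasure := Measure.prod.instIsAddHaarMeasure _ _
  haveI hHT31 : ENNReal.HolderTriple (3 / 2) 3 1 := by
    refine ⟨?_⟩
    rw [ENNReal.inv_div (Or.inr (by norm_num)) (Or.inr (by norm_num)), inv_one,
      show (3 : ℝ≥0∞)⁻¹ = 1 / 3 by rw [one_div], ENNReal.div_add_div_same,
      show (2 : ℝ≥0∞) + 1 = 3 by norm_num, ENNReal.div_self (by norm_num) (by norm_num)]
  set b := stdOrthonormalBasis ℝ E with hb
  -- ### (0) smoothness and continuity of the weights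
  have hes : IsSmoothSpaceTimeOn univ e := IsSmoothSpaceTimeOn.of_contDiff_univ he
  have hφs : IsSmoothSpaceTimeOn univ φ := hφ.isSmoothSpaceTimeOn univ
  have he_c : Continuous fun z : ℝ × E => e z.1 z.2 := hes.continuous_of_univ
  have hφ_c : Continuous fun z : ℝ × E => φ z.1 z.2 := hφs.continuous_of_univ
  have hLe_c : Continuous fun z : ℝ × E => (Δ (e z.1)) z.2 :=
    (hes.laplacian uniqueDiffOn_univ).continuous_of_univ
  have hLφ_c : Continuous fun z : ℝ × E => (Δ (φ z.1)) z.2 :=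
    (hφs.laplacian uniqueDiffOn_univ).continuous_of_univ
  have hDes : IsSmoothSpaceTimeOn univ fun t x => fderiv ℝ (e t) x := hes.fderiv_slice uniqueDiffOn_univ
  have hDe_c : Continuous fun z : ℝ × E => fderiv ℝ (e z.1) z.2 := hDes.continuous_of_univ
  have hgφ_c : Continuous fun z : ℝ × E => gradient (φ z.1) z.2 :=
    (hφs.gradient uniqueDiffOn_univ).continuous_of_univ
  have hφt_c : Continuous fun z : ℝ × E => timeDeriv φ z.1 z.2 := hφ.continuous_timeDeriv
  have hfrob_c : Continuous fun L : E →L[ℝ] E => frobeniusNormSq L := by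
    have : (fun L : E →L[ℝ] E => frobeniusNormSq L) = fun L => ∑ i, ‖L (b i)‖ ^ 2 :=
      funext fun L => frobeniusNormSq_eq_sum b L
    rw [this]
    exact continuous_finsetSum _ fun i _ =>
      ((ContinuousLinearMap.apply ℝ E (b i)).continuous.norm).pow 2
  have he2 : ∀ t, ContDiff ℝ 2 (e t) := fun t => contDiff_infty.1 (contDiff_slice_field (F := E) he t) 2
  have he1 : ∀ t, ContDiff ℝ 1 (e t) := fun t => (he2 t).of_le one_le_two
  have hed : ∀ t x, DifferentiableAt ℝ (e t) x := fun t x => (he1 t).differentiable one_ne_zero x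
  have hφ2 : ∀ t, ContDiff ℝ 2 (φ t) := fun t => contDiff_infty.1 (hφ.contDiff_slice t) 2
  have hφd : ∀ t x, DifferentiableAt ℝ (φ t) x := fun t x =>
    ((hφ2 t).differentiable (by norm_num)) x
  -- ### (1) the support and the classes of `u`, `p`, `G` on it
  set K : Set (ℝ × E) := tsupport (uncurry φ) with hK
  have hKc : IsCompact K := hφ.hasCompactSupport
  have hKΩ : K ⊆ (Ω : Set (ℝ × E)) := hφ.tsupport_subset
  have hKm : MeasurableSet K := hKc.measurableSet
  haveI hKfin : IsFiniteMeasure (volume.restrict K) := ⟨by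
    rw [Measure.restrict_apply_univ]; exact hKc.measure_lt_top⟩
  have hφK : ∀ z : ℝ × E, z ∉ K → φ z.1 z.2 = 0 := fun z hz =>
    image_eq_zero_of_notMem_tsupport (f := uncurry φ) hz
  have hφtK : ∀ z : ℝ × E, z ∉ K → timeDeriv φ z.1 z.2 = 0 := fun z hz =>
    IsSpaceTimeTestOn.timeDeriv_eq_zero_of_notMem hz
  have hnear : ∀ z : ℝ × E, z ∉ K → φ z.1 =ᶠ[𝓝 z.2] fun _ => (0 : ℝ) := fun z hz => by
    have h0 : uncurry φ =ᶠ[𝓝 (z.1, z.2)] 0 := notMem_tsupport_iff_eventuallyEq.1 hz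
    have hc : Continuous fun y : E => (z.1, y) := continuous_const.prodMk continuous_id
    exact (hc.tendsto z.2).eventually h0
  have hgφK : ∀ z : ℝ × E, z ∉ K → gradient (φ z.1) z.2 = 0 := fun z hz => by
    rw [gradient, (hnear z hz).fderiv_eq, fderiv_fun_const, Pi.zero_apply, map_zero]
  have hLφK : ∀ z : ℝ × E, z ∉ K → (Δ (φ z.1)) z.2 = 0 := fun z hz => by
    rw [(InnerProductSpace.laplacian_congr_nhds (hnear z hz)).self_of_nhds,
      InnerProductSpace.laplacian_const, Pi.zero_apply]
  -- the classes
  have huK : MemLp (uncurry u) 3 (volume.restrict K) := hu3 K hKΩ hKc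
  have hpK : MemLp (uncurry p) (3 / 2) (volume.restrict K) := hp32 K hKΩ hKc
  have hum : AEStronglyMeasurable (uncurry u) (volume.restrict K) := huK.aestronglyMeasurable
  have hpm : AEStronglyMeasurable (uncurry p) (volume.restrict K) := hpK.aestronglyMeasurable
  have hGm : AEStronglyMeasurable (uncurry G) (volume.restrict K) :=
    (hG.locallyIntegrableOn_grad.aestronglyMeasurable).mono_measure (Measure.restrict_mono hKΩ le_rfl)
  have hum' : AEStronglyMeasurable (fun z : ℝ × E => u z.1 z.2) (volume.restrict K) := hum
  have hpm' : AEStronglyMeasurable (fun z : ℝ × E => p z.1 z.2) (volume.restrict K) := hpm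
  have hGm' : AEStronglyMeasurable (fun z : ℝ × E => G z.1 z.2) (volume.restrict K) := hGm
  have hu2K : MemLp (uncurry u) 2 (volume.restrict K) := huK.mono_exponent (by norm_num)
  -- integrable dominating functions on `K`
  have gU2 : IntegrableOn (fun z : ℝ × E => ‖u z.1 z.2‖ ^ 2) K volume :=
    hu2K.integrable_norm_pow two_ne_zero
  have gU3 : IntegrableOn (fun z : ℝ × E => ‖u z.1 z.2‖ ^ 3) K volume :=
    huK.integrable_norm_pow (by norm_num)
  have gU1 : IntegrableOn (fun z : ℝ × E => ‖u z.1 z.2‖) K volume :=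
    (huK.integrable (by norm_num)).norm
  have h1le32 : (1 : ℝ≥0∞) ≤ 3 / 2 := by
    rw [ENNReal.le_div_iff_mul_le (Or.inl (by norm_num)) (Or.inl (by norm_num))]
    norm_num
  have gP1 : IntegrableOn (fun z : ℝ × E => ‖p z.1 z.2‖) K volume :=
    (hpK.integrable h1le32).norm
  have gPU : IntegrableOn (fun z : ℝ × E => ‖p z.1 z.2‖ * ‖u z.1 z.2‖) K volume := by
    have h := MemLp.mul' (r := 1) (f := fun z : ℝ × E => ‖u z.1 z.2‖)
      (φ := fun z : ℝ × E => ‖p z.1 z.2‖) huK.norm hpK.norm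
    exact memLp_one_iff_integrable.1 h
  have gG2 : IntegrableOn (fun z : ℝ × E => frobeniusNormSq (G z.1 z.2)) K volume := by
    refine ⟨(hfrob_c.comp_aestronglyMeasurable hGm'), ?_⟩
    have hfin := hG2 K hKΩ hKc
    refine lt_of_le_of_lt (lintegral_mono fun z => ?_) hfin
    rw [Real.enorm_eq_ofReal (frobeniusNormSq_nonneg _)]
  have gGi : ∀ i, IntegrableOn (fun z : ℝ × E => ‖G z.1 z.2 (b i)‖) K volume := by
    intro i
    have hmeas : AEStronglyMeasurable (fun z : ℝ × E => G z.1 z.2 (b i)) (volume.restrict K) :=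
      (ContinuousLinearMap.apply ℝ E (b i)).continuous.comp_aestronglyMeasurable hGm'
    have h2 : MemLp (fun z : ℝ × E => G z.1 z.2 (b i)) 2 (volume.restrict K) := by
      refine (memLp_two_iff_integrable_sq_norm hmeas).2 ?_
      refine Integrable.mono' gG2 (hmeas.norm.pow 2) (Eventually.of_forall fun z => ?_)
      rw [Real.norm_eq_abs, abs_of_nonneg (sq_nonneg _)]
      exact norm_apply_sq_le_frobeniusNormSq b _ i
    exact (h2.integrable one_le_two).norm
  -- bounds of the weights on `K`
  obtain ⟨Cφ, hCφ0, hCφ⟩ := exists_forall_mem_norm_le_of_continuous hKc hφ_c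
  obtain ⟨Cφt, hCφt0, hCφt⟩ := exists_forall_mem_norm_le_of_continuous hKc hφt_c
  obtain ⟨CLφ, hCLφ0, hCLφ⟩ := exists_forall_mem_norm_le_of_continuous hKc hLφ_c
  obtain ⟨Cgφ, hCgφ0, hCgφ⟩ := exists_forall_mem_norm_le_of_continuous hKc hgφ_c
  obtain ⟨Ce, hCe0, hCe⟩ := exists_forall_mem_norm_le_of_continuous hKc he_c
  obtain ⟨CDe, hCDe0, hCDe⟩ := exists_forall_mem_norm_le_of_continuous hKc hDe_c
  obtain ⟨CLe, hCLe0, hCLe⟩ := exists_forall_mem_norm_le_of_continuous hKc hLe_c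
  have hDeu : AEStronglyMeasurable (fun z : ℝ × E => fderiv ℝ (e z.1) z.2 (u z.1 z.2))
      (volume.restrict K) :=
    (isBoundedBilinearMap_apply (𝕜 := ℝ) (E := E) (F := E)).continuous.comp_aestronglyMeasurable₂
      hDe_c.aestronglyMeasurable hum'
  have iP3 : Integrable (fun z : ℝ × E =>
      φ z.1 z.2 * ⟪fderiv ℝ (e z.1) z.2 (u z.1 z.2), u z.1 z.2⟫) volume := by
    refine integrable_of_bound_on_compact hKc (gU2.const_mul (Cφ * CDe))
      (hφ_c.aestronglyMeasurable.mul (hDeu.inner hum'))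
      (fun z hz => by rw [hφK z hz, zero_mul]) fun z hz => ?_
    rw [norm_mul]
    calc ‖φ z.1 z.2‖ * ‖⟪fderiv ℝ (e z.1) z.2 (u z.1 z.2), u z.1 z.2⟫‖
        ≤ Cφ * ((CDe * ‖u z.1 z.2‖) * ‖u z.1 z.2‖) :=
          mul_le_mul (hCφ z hz) ((norm_inner_le_norm _ _).trans (mul_le_mul_of_nonneg_right
            ((ContinuousLinearMap.le_opNorm _ _).trans (mul_le_mul_of_nonneg_right (hCDe z hz)
            (norm_nonneg _))) (norm_nonneg _))) (norm_nonneg _) hCφ0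
      _ = Cφ * CDe * ‖u z.1 z.2‖ ^ 2 := by ring
  -- the classes of `w = u - e` on `K`
  have hwm' : AEStronglyMeasurable (fun z : ℝ × E => u z.1 z.2 - e z.1 z.2) (volume.restrict K) :=
    hum'.sub he_c.aestronglyMeasurable
  have gW2 : IntegrableOn (fun z : ℝ × E => ‖u z.1 z.2 - e z.1 z.2‖ ^ 2) K volume := by
    refine Integrable.mono' ((gU2.const_mul 2).add (integrableOn_const (C := 2 * Ce ^ 2)
      (hs := hKc.measure_lt_top.ne) |>.integrable)) (hwm'.norm.pow 2) ?_
    refine (ae_restrict_iff' hKm).2 (Eventually.of_forall fun z hz => ?_)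
    rw [Real.norm_eq_abs, abs_of_nonneg (sq_nonneg _)]
    calc ‖u z.1 z.2 - e z.1 z.2‖ ^ 2 ≤ (‖u z.1 z.2‖ + ‖e z.1 z.2‖) ^ 2 := by
          gcongr; exact norm_sub_le _ _
      _ ≤ 2 * ‖u z.1 z.2‖ ^ 2 + 2 * ‖e z.1 z.2‖ ^ 2 := by nlinarith [sq_nonneg (‖u z.1 z.2‖ - ‖e z.1 z.2‖)]
      _ ≤ 2 * ‖u z.1 z.2‖ ^ 2 + 2 * Ce ^ 2 := by
          have := hCe z hz
          nlinarith [norm_nonneg (e z.1 z.2)]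
  -- ### integrands of the expansion
  have hDw_c : AEStronglyMeasurable (fun z : ℝ × E => fderiv ℝ (e z.1) z.2 (u z.1 z.2 - e z.1 z.2))
      (volume.restrict K) :=
    (isBoundedBilinearMap_apply (𝕜 := ℝ) (E := E) (F := E)).continuous.comp_aestronglyMeasurable₂
      hDe_c.aestronglyMeasurable hwm'
  have hDee_c : Continuous fun z : ℝ × E => fderiv ℝ (e z.1) z.2 (e z.1 z.2) := hDe_c.clm_apply he_c
  -- `φ ⟪De(w), w⟫`, `φ ⟪De(w), e⟫`, `φ ⟪De(e), w⟫`, `φ ⟪De(e), e⟫`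
  have iT1 : Integrable (fun z : ℝ × E =>
      φ z.1 z.2 * ⟪fderiv ℝ (e z.1) z.2 (u z.1 z.2 - e z.1 z.2), u z.1 z.2 - e z.1 z.2⟫) volume := by
    refine integrable_of_bound_on_compact hKc (gW2.const_mul (Cφ * CDe))
      (hφ_c.aestronglyMeasurable.mul (hDw_c.inner hwm'))
      (fun z hz => by rw [hφK z hz, zero_mul]) fun z hz => ?_
    rw [norm_mul]
    calc ‖φ z.1 z.2‖ * ‖⟪fderiv ℝ (e z.1) z.2 (u z.1 z.2 - e z.1 z.2), u z.1 z.2 - e z.1 z.2⟫‖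
        ≤ Cφ * ((CDe * ‖u z.1 z.2 - e z.1 z.2‖) * ‖u z.1 z.2 - e z.1 z.2‖) :=
          mul_le_mul (hCφ z hz) ((norm_inner_le_norm _ _).trans (mul_le_mul_of_nonneg_right
            ((ContinuousLinearMap.le_opNorm _ _).trans (mul_le_mul_of_nonneg_right (hCDe z hz)
            (norm_nonneg _))) (norm_nonneg _))) (norm_nonneg _) hCφ0
      _ = Cφ * CDe * ‖u z.1 z.2 - e z.1 z.2‖ ^ 2 := by ring
  have iD2 : Integrable (fun z : ℝ × E =>
      φ z.1 z.2 * ⟪fderiv ℝ (e z.1) z.2 (u z.1 z.2 - e z.1 z.2), e z.1 z.2⟫) volume := by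
    have gW1 : IntegrableOn (fun z : ℝ × E => ‖u z.1 z.2 - e z.1 z.2‖) K volume :=
      Integrable.mono' (gU1.add (integrableOn_const (C := Ce) (hs := hKc.measure_lt_top.ne)
        |>.integrable)) hwm'.norm ((ae_restrict_iff' hKm).2 (Eventually.of_forall fun z hz => by
          rw [norm_norm]; exact (norm_sub_le _ _).trans (add_le_add le_rfl (hCe z hz))))
    refine integrable_of_bound_on_compact hKc (gW1.const_mul (Cφ * CDe * Ce))
      (hφ_c.aestronglyMeasurable.mul (hDw_c.inner he_c.aestronglyMeasurable))
      (fun z hz => by rw [hφK z hz, zero_mul]) fun z hz => ?_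
    rw [norm_mul]
    calc ‖φ z.1 z.2‖ * ‖⟪fderiv ℝ (e z.1) z.2 (u z.1 z.2 - e z.1 z.2), e z.1 z.2⟫‖
        ≤ Cφ * ((CDe * ‖u z.1 z.2 - e z.1 z.2‖) * Ce) :=
          mul_le_mul (hCφ z hz) ((norm_inner_le_norm _ _).trans (mul_le_mul
            ((ContinuousLinearMap.le_opNorm _ _).trans (mul_le_mul_of_nonneg_right (hCDe z hz)
            (norm_nonneg _))) (hCe z hz) (norm_nonneg _) (by positivity))) (norm_nonneg _) hCφ0
      _ = Cφ * CDe * Ce * ‖u z.1 z.2 - e z.1 z.2‖ := by ring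
  have iT2 : Integrable (fun z : ℝ × E =>
      φ z.1 z.2 * ⟪fderiv ℝ (e z.1) z.2 (e z.1 z.2), u z.1 z.2 - e z.1 z.2⟫) volume := by
    have gW1 : IntegrableOn (fun z : ℝ × E => ‖u z.1 z.2 - e z.1 z.2‖) K volume :=
      Integrable.mono' (gU1.add (integrableOn_const (C := Ce) (hs := hKc.measure_lt_top.ne)
        |>.integrable)) hwm'.norm ((ae_restrict_iff' hKm).2 (Eventually.of_forall fun z hz => by
          rw [norm_norm]; exact (norm_sub_le _ _).trans (add_le_add le_rfl (hCe z hz))))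
    refine integrable_of_bound_on_compact hKc (gW1.const_mul (Cφ * (CDe * Ce)))
      (hφ_c.aestronglyMeasurable.mul (hDee_c.aestronglyMeasurable.inner hwm'))
      (fun z hz => by rw [hφK z hz, zero_mul]) fun z hz => ?_
    rw [norm_mul]
    calc ‖φ z.1 z.2‖ * ‖⟪fderiv ℝ (e z.1) z.2 (e z.1 z.2), u z.1 z.2 - e z.1 z.2⟫‖
        ≤ Cφ * ((CDe * Ce) * ‖u z.1 z.2 - e z.1 z.2‖) :=
          mul_le_mul (hCφ z hz) ((norm_inner_le_norm _ _).trans (mul_le_mul_of_nonneg_right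
            ((ContinuousLinearMap.le_opNorm _ _).trans (mul_le_mul (hCDe z hz) (hCe z hz)
            (norm_nonneg _) hCDe0)) (norm_nonneg _))) (norm_nonneg _) hCφ0
      _ = Cφ * (CDe * Ce) * ‖u z.1 z.2 - e z.1 z.2‖ := by ring
  have hint : ∀ {f : ℝ × E → ℝ}, Continuous f → (∀ z ∉ K, f z = 0) → Integrable f volume :=
    fun hf h0 => hf.integrable_of_hasCompactSupport (HasCompactSupport.intro hKc h0)
  have iD3 : Integrable (fun z : ℝ × E => φ z.1 z.2 * ⟪fderiv ℝ (e z.1) z.2 (e z.1 z.2), e z.1 z.2⟫) volume :=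
    hint (hφ_c.mul (hDee_c.inner he_c)) fun z hz => by rw [hφK z hz, zero_mul]
  -- the splitting `⟪De(u), u⟫ = ⟪De(w), w⟫ + ⟪De(w), e⟫ + ⟪De(e), w⟫ + ⟪De(e), e⟫`
  have hP3_pt : ∀ z : ℝ × E, φ z.1 z.2 * ⟪fderiv ℝ (e z.1) z.2 (u z.1 z.2), u z.1 z.2⟫ =
      φ z.1 z.2 * ⟪fderiv ℝ (e z.1) z.2 (u z.1 z.2 - e z.1 z.2), u z.1 z.2 - e z.1 z.2⟫ +
        (φ z.1 z.2 * ⟪fderiv ℝ (e z.1) z.2 (u z.1 z.2 - e z.1 z.2), e z.1 z.2⟫ +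
        (φ z.1 z.2 * ⟪fderiv ℝ (e z.1) z.2 (e z.1 z.2), u z.1 z.2 - e z.1 z.2⟫ +
        φ z.1 z.2 * ⟪fderiv ℝ (e z.1) z.2 (e z.1 z.2), e z.1 z.2⟫)) := by
    intro z
    have hu : u z.1 z.2 = (u z.1 z.2 - e z.1 z.2) + e z.1 z.2 := (sub_add_cancel _ _).symm
    conv_lhs => rw [hu]
    simp only [map_add, inner_add_left, inner_add_right]
    ring
  have hP3 : ∫ t, ∫ x, φ t x * ⟪fderiv ℝ (e t) x (u t x), u t x⟫ =
      (∫ z : ℝ × E, φ z.1 z.2 * ⟪fderiv ℝ (e z.1) z.2 (u z.1 z.2 - e z.1 z.2), u z.1 z.2 - e z.1 z.2⟫) +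
      ((∫ z : ℝ × E, φ z.1 z.2 * ⟪fderiv ℝ (e z.1) z.2 (u z.1 z.2 - e z.1 z.2), e z.1 z.2⟫) +
      ((∫ z : ℝ × E, φ z.1 z.2 * ⟪fderiv ℝ (e z.1) z.2 (e z.1 z.2), u z.1 z.2 - e z.1 z.2⟫) +
      ∫ z : ℝ × E, φ z.1 z.2 * ⟪fderiv ℝ (e z.1) z.2 (e z.1 z.2), e z.1 z.2⟫)) := by
    rw [← integral_prod (μ := volume) (ν := volume) _ iP3]
    change ∫ z : ℝ × E, φ z.1 z.2 * ⟪fderiv ℝ (e z.1) z.2 (u z.1 z.2), u z.1 z.2⟫ = _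
    have i34 : Integrable (fun z : ℝ × E =>
        φ z.1 z.2 * ⟪fderiv ℝ (e z.1) z.2 (e z.1 z.2), u z.1 z.2 - e z.1 z.2⟫ +
        φ z.1 z.2 * ⟪fderiv ℝ (e z.1) z.2 (e z.1 z.2), e z.1 z.2⟫) volume := iT2.add iD3
    have i234 : Integrable (fun z : ℝ × E =>
        φ z.1 z.2 * ⟪fderiv ℝ (e z.1) z.2 (u z.1 z.2 - e z.1 z.2), e z.1 z.2⟫ +
        (φ z.1 z.2 * ⟪fderiv ℝ (e z.1) z.2 (e z.1 z.2), u z.1 z.2 - e z.1 z.2⟫ +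
        φ z.1 z.2 * ⟪fderiv ℝ (e z.1) z.2 (e z.1 z.2), e z.1 z.2⟫)) volume := iD2.add i34
    rw [funext hP3_pt, integral_add iT1 i234, integral_add iD2 i34, integral_add iT2 iD3]
  -- ### (ii) weak divergence-freeness tested with `θ = ½ |e|² φ`
  have hθs : ContDiff ℝ ((⊤ : ℕ∞) : WithTop ℕ∞) (uncurry fun t x => (1 / 2 : ℝ) * ‖e t x‖ ^ 2) := by
    have : (uncurry fun t x => (1 / 2 : ℝ) * ‖e t x‖ ^ 2) = fun z => (1 / 2 : ℝ) * ‖uncurry e z‖ ^ 2 := rfl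
    rw [this]
    exact contDiff_const.mul (he.norm_sq (𝕜 := ℝ))
  have hθ : IsSpaceTimeTestOn Ω fun t x => φ t x * ((1 / 2 : ℝ) * ‖e t x‖ ^ 2) := hφ.mul_smooth hθs
  have hgradθ : ∀ t x (v : E), ⟪v, gradient (fun y => φ t y * ((1 / 2 : ℝ) * ‖e t y‖ ^ 2)) x⟫ =
      φ t x * ⟪fderiv ℝ (e t) x v, e t x⟫ + (1 / 2 : ℝ) * ‖e t x‖ ^ 2 * ⟪v, gradient (φ t) x⟫ := by
    intro t x v
    have hn2 : DifferentiableAt ℝ (fun y => ‖e t y‖ ^ 2) x := (hed t x).norm_sq (𝕜 := ℝ)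
    have hn : DifferentiableAt ℝ (fun y => (1 / 2 : ℝ) * ‖e t y‖ ^ 2) x := hn2.const_mul _
    rw [real_inner_comm, gradient, InnerProductSpace.toDual_symm_apply, fderiv_fun_mul (hφd t x) hn,
      fderiv_const_mul hn2]
    have h2 : fderiv ℝ (fun y => ‖e t y‖ ^ 2) x v = 2 * ⟪fderiv ℝ (e t) x v, e t x⟫ := by
      have : (fun y => ‖e t y‖ ^ 2) = fun y => ⟪e t y, e t y⟫ := funext fun y =>
        (real_inner_self_eq_norm_sq _).symm
      rw [this, fderiv_inner_apply ℝ (hed t x) (hed t x), real_inner_comm (e t x)]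
      ring
    simp only [_root_.add_apply, _root_.FunLike.coe_smul, Pi.smul_apply, smul_eq_mul, h2]
    rw [real_inner_comm (gradient (φ t) x), gradient, InnerProductSpace.toDual_symm_apply]
    ring
  -- for `u` (weakly divergence free on `Ω`)
  have i_ue : Integrable (fun z : ℝ × E => (1 / 2 : ℝ) * ‖e z.1 z.2‖ ^ 2 * ⟪u z.1 z.2, gradient (φ z.1) z.2⟫)
      volume := by
    refine integrable_of_bound_on_compact hKc (gU1.const_mul ((1 / 2 : ℝ) * Ce ^ 2 * Cgφ))
      ((continuous_const.mul (he_c.norm.pow 2)).aestronglyMeasurable.mul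
        (hum'.inner hgφ_c.aestronglyMeasurable))
      (fun z hz => by rw [hgφK z hz, inner_zero_right, mul_zero]) fun z hz => ?_
    rw [norm_mul, norm_mul, Real.norm_eq_abs, abs_of_nonneg (by norm_num : (0 : ℝ) ≤ 1 / 2),
      Real.norm_eq_abs, abs_of_nonneg (sq_nonneg _)]
    calc (1 / 2 : ℝ) * ‖e z.1 z.2‖ ^ 2 * ‖⟪u z.1 z.2, gradient (φ z.1) z.2⟫‖
        ≤ (1 / 2 : ℝ) * Ce ^ 2 * (‖u z.1 z.2‖ * Cgφ) := by
          refine mul_le_mul (mul_le_mul_of_nonneg_left ?_ (by norm_num)) ((norm_inner_le_norm _ _).trans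
            (mul_le_mul_of_nonneg_left (hCgφ z hz) (norm_nonneg _))) (norm_nonneg _) (by positivity)
          have := hCe z hz
          exact pow_le_pow_left₀ (norm_nonneg _) this 2
      _ = (1 / 2 : ℝ) * Ce ^ 2 * Cgφ * ‖u z.1 z.2‖ := by ring
  have iP3u : Integrable (fun z : ℝ × E => φ z.1 z.2 * ⟪fderiv ℝ (e z.1) z.2 (u z.1 z.2), e z.1 z.2⟫)
      volume := by
    refine integrable_of_bound_on_compact hKc (gU1.const_mul (Cφ * CDe * Ce))
      (hφ_c.aestronglyMeasurable.mul (hDeu.inner he_c.aestronglyMeasurable))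
      (fun z hz => by rw [hφK z hz, zero_mul]) fun z hz => ?_
    rw [norm_mul]
    calc ‖φ z.1 z.2‖ * ‖⟪fderiv ℝ (e z.1) z.2 (u z.1 z.2), e z.1 z.2⟫‖
        ≤ Cφ * ((CDe * ‖u z.1 z.2‖) * Ce) :=
          mul_le_mul (hCφ z hz) ((norm_inner_le_norm _ _).trans (mul_le_mul
            ((ContinuousLinearMap.le_opNorm _ _).trans (mul_le_mul_of_nonneg_right (hCDe z hz)
            (norm_nonneg _))) (hCe z hz) (norm_nonneg _) (by positivity))) (norm_nonneg _) hCφ0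
      _ = Cφ * CDe * Ce * ‖u z.1 z.2‖ := by ring
  have hD_u : (∫ z : ℝ × E, φ z.1 z.2 * ⟪fderiv ℝ (e z.1) z.2 (u z.1 z.2), e z.1 z.2⟫) +
      ∫ z : ℝ × E, (1 / 2 : ℝ) * ‖e z.1 z.2‖ ^ 2 * ⟪u z.1 z.2, gradient (φ z.1) z.2⟫ = 0 := by
    have h0 := hNS.2.2.2.1 _ hθ
    rw [setIntegral_eq_integral_of_forall_compl_eq_zero (fun z hz => by
      have hzK : z ∉ K := fun h => hz (hKΩ h)
      rw [hgradθ, hφK z hzK, hgφK z hzK, inner_zero_right, zero_mul, mul_zero, add_zero])] at h0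
    simp only [hgradθ] at h0
    rwa [integral_add iP3u i_ue] at h0
  -- for `e` (classically divergence free), slice by slice
  have hD_e : (∫ z : ℝ × E, φ z.1 z.2 * ⟪fderiv ℝ (e z.1) z.2 (e z.1 z.2), e z.1 z.2⟫) +
      ∫ z : ℝ × E, (1 / 2 : ℝ) * ‖e z.1 z.2‖ ^ 2 * ⟪e z.1 z.2, gradient (φ z.1) z.2⟫ = 0 := by
    have i_ee : Integrable (fun z : ℝ × E => (1 / 2 : ℝ) * ‖e z.1 z.2‖ ^ 2 * ⟪e z.1 z.2, gradient (φ z.1) z.2⟫)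
        volume := hint ((continuous_const.mul (he_c.norm.pow 2)).mul (he_c.inner hgφ_c))
          fun z hz => by rw [hgφK z hz, inner_zero_right, mul_zero]
    have isum : Integrable (fun z : ℝ × E => φ z.1 z.2 * ⟪fderiv ℝ (e z.1) z.2 (e z.1 z.2), e z.1 z.2⟫ +
        (1 / 2 : ℝ) * ‖e z.1 z.2‖ ^ 2 * ⟪e z.1 z.2, gradient (φ z.1) z.2⟫) volume := iD3.add i_ee
    rw [← integral_add iD3 i_ee, Measure.volume_eq_prod, integral_prod _ isum]
    refine integral_eq_zero_of_ae (Eventually.of_forall fun t => ?_)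
    dsimp only
    have hθ1 : ContDiff ℝ 1 fun y => φ t y * ((1 / 2 : ℝ) * ‖e t y‖ ^ 2) :=
      contDiff_infty.1 ((hθ.contDiff_slice t)) 1
    have key := integral_mul_divergence_add_eq_zero_left hθ1 (he1 t) ((hφ.hasCompactSupport_slice t).mul_right)
    simp only [hdiv t _, mul_zero, integral_zero, zero_add, hgradθ] at key
    exact key
  -- hence for `w`
  have hD2 : ∫ z : ℝ × E, φ z.1 z.2 * ⟪fderiv ℝ (e z.1) z.2 (u z.1 z.2 - e z.1 z.2), e z.1 z.2⟫ =
      -(1 / 2 : ℝ) * ∫ z : ℝ × E, ‖e z.1 z.2‖ ^ 2 * ⟪u z.1 z.2 - e z.1 z.2, gradient (φ z.1) z.2⟫ := by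
    have i_ee : Integrable (fun z : ℝ × E => (1 / 2 : ℝ) * ‖e z.1 z.2‖ ^ 2 * ⟪e z.1 z.2, gradient (φ z.1) z.2⟫)
        volume := hint ((continuous_const.mul (he_c.norm.pow 2)).mul (he_c.inner hgφ_c))
          fun z hz => by rw [hgφK z hz, inner_zero_right, mul_zero]
    have e1 : (fun z : ℝ × E => φ z.1 z.2 * ⟪fderiv ℝ (e z.1) z.2 (u z.1 z.2 - e z.1 z.2), e z.1 z.2⟫) =
        fun z : ℝ × E => φ z.1 z.2 * ⟪fderiv ℝ (e z.1) z.2 (u z.1 z.2), e z.1 z.2⟫ -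
          φ z.1 z.2 * ⟪fderiv ℝ (e z.1) z.2 (e z.1 z.2), e z.1 z.2⟫ := by
      funext z; rw [map_sub, inner_sub_left]; ring
    have e2 : (fun z : ℝ × E => ‖e z.1 z.2‖ ^ 2 * ⟪u z.1 z.2 - e z.1 z.2, gradient (φ z.1) z.2⟫) =
        fun z : ℝ × E => 2 * ((1 / 2 : ℝ) * ‖e z.1 z.2‖ ^ 2 * ⟪u z.1 z.2, gradient (φ z.1) z.2⟫) -
          2 * ((1 / 2 : ℝ) * ‖e z.1 z.2‖ ^ 2 * ⟪e z.1 z.2, gradient (φ z.1) z.2⟫) := by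
      funext z; rw [inner_sub_left]; ring
    rw [e1, e2, integral_sub iP3u iD3, integral_sub (i_ue.const_mul 2) (i_ee.const_mul 2),
      integral_const_mul, integral_const_mul]
    linarith
  have hD3 : ∫ z : ℝ × E, φ z.1 z.2 * ⟪fderiv ℝ (e z.1) z.2 (e z.1 z.2), e z.1 z.2⟫ =
      -(1 / 2 : ℝ) * ∫ z : ℝ × E, ⟪e z.1 z.2, gradient (φ z.1) z.2⟫ * ‖e z.1 z.2‖ ^ 2 := by
    have i_ee : Integrable (fun z : ℝ × E => (1 / 2 : ℝ) * ‖e z.1 z.2‖ ^ 2 * ⟪e z.1 z.2, gradient (φ z.1) z.2⟫)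
        volume := hint ((continuous_const.mul (he_c.norm.pow 2)).mul (he_c.inner hgφ_c))
          fun z hz => by rw [hgφK z hz, inner_zero_right, mul_zero]
    have e2 : (fun z : ℝ × E => ⟪e z.1 z.2, gradient (φ z.1) z.2⟫ * ‖e z.1 z.2‖ ^ 2) =
        fun z : ℝ × E => 2 * ((1 / 2 : ℝ) * ‖e z.1 z.2‖ ^ 2 * ⟪e z.1 z.2, gradient (φ z.1) z.2⟫) := by
      funext z; ring
    rw [e2, integral_const_mul]
    linarith

  -- ### (iii) conclusion: the product integrals in iterated form
  have gW1 : IntegrableOn (fun z : ℝ × E => ‖u z.1 z.2 - e z.1 z.2‖) K volume :=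
    Integrable.mono' (gU1.add (integrableOn_const (C := Ce) (hs := hKc.measure_lt_top.ne)
      |>.integrable)) hwm'.norm ((ae_restrict_iff' hKm).2 (Eventually.of_forall fun z hz => by
        rw [norm_norm]; exact (norm_sub_le _ _).trans (add_le_add le_rfl (hCe z hz))))
  have i_e2w : Integrable (fun z : ℝ × E => ‖e z.1 z.2‖ ^ 2 * ⟪u z.1 z.2 - e z.1 z.2, gradient (φ z.1) z.2⟫)
      volume := by
    refine integrable_of_bound_on_compact hKc (gW1.const_mul (Ce ^ 2 * Cgφ))
      ((he_c.norm.pow 2).aestronglyMeasurable.mul (hwm'.inner hgφ_c.aestronglyMeasurable))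
      (fun z hz => by rw [hgφK z hz, inner_zero_right, mul_zero]) fun z hz => ?_
    rw [norm_mul, Real.norm_eq_abs, abs_of_nonneg (sq_nonneg _)]
    calc ‖e z.1 z.2‖ ^ 2 * ‖⟪u z.1 z.2 - e z.1 z.2, gradient (φ z.1) z.2⟫‖
        ≤ Ce ^ 2 * (‖u z.1 z.2 - e z.1 z.2‖ * Cgφ) :=
          mul_le_mul (pow_le_pow_left₀ (norm_nonneg _) (hCe z hz) 2) ((norm_inner_le_norm _ _).trans
            (mul_le_mul_of_nonneg_left (hCgφ z hz) (norm_nonneg _))) (norm_nonneg _) (by positivity)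
      _ = Ce ^ 2 * Cgφ * ‖u z.1 z.2 - e z.1 z.2‖ := by ring
  have i_ege2 : Integrable (fun z : ℝ × E => ⟪e z.1 z.2, gradient (φ z.1) z.2⟫ * ‖e z.1 z.2‖ ^ 2) volume :=
    hint ((he_c.inner hgφ_c).mul (he_c.norm.pow 2)) fun z hz => by rw [hgφK z hz, inner_zero_right, zero_mul]
  have c1 : ∫ t, ∫ x, φ t x * ⟪fderiv ℝ (e t) x (u t x - e t x), u t x - e t x⟫ =
      ∫ z : ℝ × E, φ z.1 z.2 * ⟪fderiv ℝ (e z.1) z.2 (u z.1 z.2 - e z.1 z.2), u z.1 z.2 - e z.1 z.2⟫ :=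
    (integral_prod (μ := volume) (ν := volume) _ iT1).symm
  have c2 : ∫ t, ∫ x, φ t x * ⟪fderiv ℝ (e t) x (e t x), u t x - e t x⟫ =
      ∫ z : ℝ × E, φ z.1 z.2 * ⟪fderiv ℝ (e z.1) z.2 (e z.1 z.2), u z.1 z.2 - e z.1 z.2⟫ :=
    (integral_prod (μ := volume) (ν := volume) _ iT2).symm
  have c3 : ∫ t, ∫ x, ‖e t x‖ ^ 2 * ⟪u t x - e t x, gradient (φ t) x⟫ =
      ∫ z : ℝ × E, ‖e z.1 z.2‖ ^ 2 * ⟪u z.1 z.2 - e z.1 z.2, gradient (φ z.1) z.2⟫ :=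
    (integral_prod (μ := volume) (ν := volume) _ i_e2w).symm
  have c5 : ∫ t, ∫ x, ⟪e t x, gradient (φ t) x⟫ * ‖e t x‖ ^ 2 =
      ∫ z : ℝ × E, ⟪e z.1 z.2, gradient (φ z.1) z.2⟫ * ‖e z.1 z.2‖ ^ 2 :=
    (integral_prod (μ := volume) (ν := volume) _ i_ege2).symm
  rw [c1, c2, c3, c5]
  rw [hP3] at h4
  linarith [h4, hD2, hD3]

end Main

end Literature.Analysis.FluidPDE

end
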